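import Mathlib.Analysis.SpecificLimits.Normed
import Mathlib.Data.ZMod.ValMinAbs
import Literature.MathematicalPhysics.QuantumLattice.OverlapLocality
import Literature.MathematicalPhysics.QuantumLattice.LiebRobinsonFnwGapConvergenceProofs
import HarnessLib

/-!
# Heavy-mass Wilson propagator: invertibility and configuration-wise exponential decay

Topic `Literature/MathematicalPhysics/QuantumLattice`; namespace
`Literature.MathematicalPhysics.QuantumLattice`.

For the tree's Wilson–Dirac matrix `wilsonDirac ρ U m 1` (`r = 1`, unitary representation `ρ`,
periodic torus `(ℤ/L)⁴`, ANY gauge field `U`) at bare mass `m > 0` — i.e. hopping parameter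
`κ = 1/(2m+8) < 1/8` — the hopping-parameter (Neumann) series
`D_W⁻¹ = (m+4)⁻¹ Σ_{n≥0} xⁿ`, `x = (m+4)⁻¹ Σ_μ W_μ`, converges in operator norm because
`‖Σ_μ W_μ‖ ≤ 4` (HJL (2.14), tree `l2_opNorm_wilsonHop_le`), and `xⁿ` couples only sites within
`n` hops.  Consequences proved here, uniformly in the volume and in the gauge field:

* `wilsonDirac_det_ne_zero_of_pos` — `det D_W(m) ≠ 0` for `m > 0`;
* `norm_inv_wilsonDirac_apply_le` — `|D_W(m)⁻¹(p,q)| ≤ (m+4)⁻¹(1 − 4/(m+4))⁻¹ (4/(m+4))^{d_i(p,q)}`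
  (`= m⁻¹ (4/(m+4))^{d_i}`) for every coordinate `i`, where `d_i(p,q)` is the cyclic distance of the
  `i`-th site coordinates (`ZMod.valMinAbs`), in particular `≥` decay in the sup-distance.

This is the convergence half of the hopping-parameter expansion (Montvay–Münster §4.1/§5.1: the
expansion in `κ` converges for `κ < 1/(2d)`; here `d = 4`), written for the tree's conventions.
Ingredients: support of `D_W` (diagonal or nearest neighbours, read off the tree definition),
finite range of powers of a nearest-neighbour matrix in each cyclic coordinate distance
(`pow_apply_eq_zero_of_lt_valMinAbs`), entries bounded by the `ℓ²` operator norm (tree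
`norm_apply_le_l2_opNorm`), and the
geometric series in the complete normed ring of matrices (`mul_neg_geom_series`).

Not here: optimal constants (the true decay rate is `arcosh`-type), the `r ≠ 1` case, Dirichlet
boxes, and anything about the measure (these bounds are configuration-wise).

References: I. Montvay, G. Münster, *Quantum Fields on a Lattice* (CUP 1994), §4.1 and §5.1
(hopping parameter expansion) [MontvayMunster1994]; P. Hernández, K. Jansen, M. Lüscher,
Nucl. Phys. B 552 (1999) 363, (2.14) [HernandezJansenLuscher1999].
-/

noncomputable section

open Matrix Finset
open scoped Matrix.Norms.L2Operator
open Literature.Probability.LatticeModels (TorusSite)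
open Literature.MathematicalPhysics.QuantumFieldTheory

namespace Literature.MathematicalPhysics.QuantumLattice

/-! ### Cyclic distance bookkeeping in `ZMod L` -/

/-- The cyclic distance `|valMinAbs z|` of a residue to `0` is at most `|k|` for any integer
representative `k`. [folklore] -/
theorem natAbs_valMinAbs_intCast_le {L : ℕ} [NeZero L] (k : ℤ) :
    ((k : ZMod L)).valMinAbs.natAbs ≤ k.natAbs :=
  ZMod.natAbs_min_of_le_div_two L _ _ (ZMod.coe_valMinAbs _) (ZMod.natAbs_valMinAbs_le _)

/-- Subadditivity of the cyclic distance. [folklore] -/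
theorem natAbs_valMinAbs_add_le' {L : ℕ} [NeZero L] (a b : ZMod L) :
    (a + b).valMinAbs.natAbs ≤ a.valMinAbs.natAbs + b.valMinAbs.natAbs :=
  (ZMod.natAbs_valMinAbs_add_le a b).trans (Int.natAbs_add_le _ _)

/-- One step changes the cyclic distance by at most one (`+1`). [folklore] -/
theorem natAbs_valMinAbs_add_one_le {L : ℕ} [NeZero L] (a : ZMod L) :
    (a + 1).valMinAbs.natAbs ≤ a.valMinAbs.natAbs + 1 := by
  have h : (1 : ZMod L).valMinAbs.natAbs ≤ 1 := by
    simpa using natAbs_valMinAbs_intCast_le (L := L) 1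
  exact (natAbs_valMinAbs_add_le' a 1).trans (by omega)

/-- One step changes the cyclic distance by at most one (`−1`). [folklore] -/
theorem natAbs_valMinAbs_sub_one_le {L : ℕ} [NeZero L] (a : ZMod L) :
    (a - 1).valMinAbs.natAbs ≤ a.valMinAbs.natAbs + 1 := by
  have h : (-1 : ZMod L).valMinAbs.natAbs ≤ 1 := by
    simpa using natAbs_valMinAbs_intCast_le (L := L) (-1)
  rw [sub_eq_add_neg]
  exact (natAbs_valMinAbs_add_le' a (-1)).trans (by omega)

/-- On the torus of odd side `2S+1`, the cyclic distance of `-k` is `|k|` whenever `|k| ≤ S`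
(every point of the box `{-S,…,S}` is its own minimal representative). [folklore] -/
theorem natAbs_valMinAbs_neg_intCast {S : ℕ} (k : ℤ) (hk : |k| ≤ S) :
    (-(k : ZMod (2 * S + 1))).valMinAbs.natAbs = k.natAbs := by
  rw [← Int.cast_neg]
  have h : ((-k : ℤ) : ZMod (2 * S + 1)).valMinAbs = -k := by
    rw [ZMod.valMinAbs_spec]
    refine ⟨rfl, ?_, ?_⟩
    · have := abs_le.1 hk; push_cast; omega
    · have := abs_le.1 hk; push_cast; omega
  rw [h, Int.natAbs_neg]

/-! ### Support of the Wilson operator and finite range of powers -/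

variable {L N : ℕ} {G : Type*} [Group G] (ρ : G →* Matrix (Fin N) (Fin N) ℂ)

/-- **The Wilson operator couples only equal or nearest-neighbour sites**: its `(p,q)` entry
vanishes unless `p.1 = q.1` or `q.1 = p.1 ± μ̂` for some `μ` (read off the tree definition
`wilsonDirac`: mass/Wilson diagonal term plus the two hopping terms). [folklore] -/
theorem wilsonDirac_apply_eq_zero_of_far (U : GaugeConfig 4 L G) (m r : ℝ)
    {p q : TorusSite 4 L × Fin N × Fin 4} (h0 : p.1 ≠ q.1)
    (h1 : ∀ μ, q.1 ≠ QuantumFieldTheory.Site.shift p.1 μ)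
    (h2 : ∀ μ, p.1 ≠ QuantumFieldTheory.Site.shift q.1 μ) :
    wilsonDirac ρ U m r p q = 0 := by
  have hpq : p ≠ q := fun h => h0 (by rw [h])
  simp [wilsonDirac, hpq, h1, h2]

/-- **Finite range of powers of a nearest-neighbour matrix**: if `X(p,q) = 0` unless the sites
`p.1, q.1` are equal or nearest neighbours, then `Xⁿ(p,q) = 0` whenever the cyclic distance of
the `i`-th coordinates of `p.1, q.1` exceeds `n` (each factor moves coordinate `i` by at most one
step on `ℤ/L`). [folklore] -/
theorem pow_apply_eq_zero_of_lt_valMinAbs [NeZero L]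
    {X : Matrix (TorusSite 4 L × Fin N × Fin 4) (TorusSite 4 L × Fin N × Fin 4) ℂ}
    (hX : ∀ p q : TorusSite 4 L × Fin N × Fin 4,
      ¬ (p.1 = q.1 ∨ ∃ μ, q.1 = QuantumFieldTheory.Site.shift p.1 μ ∨
          p.1 = QuantumFieldTheory.Site.shift q.1 μ) → X p q = 0)
    (i : Fin 4) : ∀ (n : ℕ) (p q : TorusSite 4 L × Fin N × Fin 4),
      n < (p.1 i - q.1 i).valMinAbs.natAbs → (X ^ n) p q = 0 := by
  -- one coupled step changes the `i`-th cyclic distance by at most one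
  have hstep : ∀ {x y : TorusSite 4 L},
      (x = y ∨ ∃ μ, y = QuantumFieldTheory.Site.shift x μ ∨ x = QuantumFieldTheory.Site.shift y μ) →
      ∀ s : TorusSite 4 L, (s i - y i).valMinAbs.natAbs ≤ (s i - x i).valMinAbs.natAbs + 1 := by
    intro x y h s
    rcases h with rfl | ⟨μ, rfl | rfl⟩
    · omega
    · simp only [QuantumFieldTheory.Site.shift, Pi.add_apply, Pi.single_apply]
      split_ifs
      · rw [show s i - (x i + 1) = (s i - x i) - 1 by ring]; exact natAbs_valMinAbs_sub_one_le _
      · rw [add_zero]; omega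
    · simp only [QuantumFieldTheory.Site.shift, Pi.add_apply, Pi.single_apply]
      split_ifs
      · rw [show s i - y i = (s i - (y i + 1)) + 1 by ring]; exact natAbs_valMinAbs_add_one_le _
      · rw [add_zero]; omega
  intro n
  induction n with
  | zero =>
    intro p q h
    rw [pow_zero, Matrix.one_apply]
    split_ifs with hpq
    · subst hpq; simp at h
    · rfl
  | succ n ih =>
    intro p q h
    rw [pow_succ, Matrix.mul_apply]
    refine Finset.sum_eq_zero fun r _ => ?_
    by_cases hc : (r.1 = q.1 ∨ ∃ μ, q.1 = QuantumFieldTheory.Site.shift r.1 μ ∨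
        r.1 = QuantumFieldTheory.Site.shift q.1 μ)
    · have h1 := hstep hc p.1
      have : n < (p.1 i - r.1 i).valMinAbs.natAbs := by omega
      rw [ih p r this, zero_mul]
    · rw [hX r q hc, mul_zero]

/-! ### The Neumann (hopping-parameter) series at `m > 0` -/

section Neumann

variable [NeZero L]

omit [Group G] in
/-- `‖1‖ ≤ 1` for the `ℓ²` operator norm. [folklore] -/
theorem l2_opNorm_torusFermion_one_le :
    ‖(1 : Matrix (TorusSite 4 L × Fin N × Fin 4) (TorusSite 4 L × Fin N × Fin 4) ℂ)‖ ≤ 1 := by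
  rw [Matrix.cstar_norm_def, map_one]
  exact ContinuousLinearMap.norm_id_le

omit [NeZero L] in
/-- The hopping part `1 − (m+4)⁻¹ D_W(m) = (m+4)⁻¹ Σ_μ W_μ` (tree `wilsonDirac_eq_sub_sum_wilsonHop`).
[cite: HernandezJansenLuscher1999, (2.13)] -/
theorem one_sub_smul_wilsonDirac_eq (hρ : ∀ g, ρ g ∈ Matrix.unitaryGroup (Fin N) ℂ)
    (U : GaugeConfig 4 L G) (m : ℝ) (hc : m + 4 ≠ 0) :
    (1 : Matrix _ _ ℂ) - ((m + 4 : ℝ) : ℂ)⁻¹ • wilsonDirac ρ U m 1 =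
      ((m + 4 : ℝ) : ℂ)⁻¹ • ∑ μ, wilsonHop ρ U μ := by
  have hc' : ((m + 4 : ℝ) : ℂ) ≠ 0 := by exact_mod_cast hc
  rw [wilsonDirac_eq_sub_sum_wilsonHop ρ hρ U m, smul_sub, smul_smul, inv_mul_cancel₀ hc', one_smul,
    sub_sub_cancel]

/-- `‖1 − (m+4)⁻¹ D_W(m)‖ ≤ 4/(m+4)` for `m + 4 > 0` (four hopping isometries, HJL (2.14)).
[cite: HernandezJansenLuscher1999, (2.14)] -/
theorem norm_one_sub_smul_wilsonDirac_le (hρ : ∀ g, ρ g ∈ Matrix.unitaryGroup (Fin N) ℂ)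
    (U : GaugeConfig 4 L G) (m : ℝ) (hc : 0 < m + 4) :
    ‖(1 : Matrix _ _ ℂ) - ((m + 4 : ℝ) : ℂ)⁻¹ • wilsonDirac ρ U m 1‖ ≤ 4 / (m + 4) := by
  rw [one_sub_smul_wilsonDirac_eq ρ hρ U m hc.ne', norm_smul, norm_inv, Complex.norm_real,
    Real.norm_eq_abs, abs_of_pos hc, div_eq_inv_mul]
  gcongr
  calc ‖∑ μ, wilsonHop ρ U μ‖ ≤ ∑ μ, ‖wilsonHop ρ U μ‖ := norm_sum_le _ _
    _ ≤ ∑ _μ : Fin 4, (1 : ℝ) := Finset.sum_le_sum fun μ _ => l2_opNorm_wilsonHop_le ρ hρ U μ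
    _ = 4 := by simp

omit [Group G] [NeZero L] in
/-- Tail form of the geometric series from `(1 − x) S = 1` in any ring: `S = Σ_{n<d} xⁿ + x^d S`.
[folklore] -/
theorem geom_series_eq_sum_add_pow_mul {R : Type*} [Ring R] {x S : R} (h : (1 - x) * S = 1) (d : ℕ) :
    S = (∑ n ∈ Finset.range d, x ^ n) + x ^ d * S := by
  have hS : S = 1 + x * S := by
    rw [sub_mul, one_mul] at h
    exact sub_eq_iff_eq_add.1 h
  induction d with
  | zero => simp
  | succ d ih =>
    rw [Finset.sum_range_succ, pow_succ, add_assoc]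
    have : x ^ d * S = x ^ d + x ^ d * x * S := by
      conv_lhs => rw [hS]
      rw [mul_add, mul_one, mul_assoc]
    rw [← this]
    exact ih

/-- **Heavy-mass Wilson propagator: invertibility and exponential decay, configuration-wise.**
For bare mass `m > 0` (`κ < 1/8`), on every periodic torus and for every gauge field, `D_W(m)` has
non-zero determinant and
`|D_W(m)⁻¹(p,q)| ≤ (m+4)⁻¹ (1 − 4/(m+4))⁻¹ (4/(m+4))^{d_i(p,q)}` for each coordinate `i`, `d_i` the
cyclic distance of the `i`-th site coordinates.  Proof: `D = (m+4)(1 − x)`, `‖x‖ ≤ 4/(m+4) < 1`,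
`D⁻¹ = (m+4)⁻¹ Σ_n xⁿ` (complete normed ring), and `xⁿ(p,q) = 0` for `n < d_i(p,q)` so only the
tail `x^{d} Σ_n xⁿ` contributes to the entry — the convergent hopping-parameter expansion.
[cite: MontvayMunster1994, §4.1 and §5.1 (hopping parameter expansion)] -/
theorem norm_inv_wilsonDirac_apply_le (hρ : ∀ g, ρ g ∈ Matrix.unitaryGroup (Fin N) ℂ)
    (U : GaugeConfig 4 L G) {m : ℝ} (hm : 0 < m) (p q : TorusSite 4 L × Fin N × Fin 4) (i : Fin 4) :
    (wilsonDirac ρ U m 1).det ≠ 0 ∧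
    ‖(wilsonDirac ρ U m 1)⁻¹ p q‖ ≤
      (m + 4)⁻¹ * (1 - 4 / (m + 4))⁻¹ * (4 / (m + 4)) ^ (p.1 i - q.1 i).valMinAbs.natAbs := by
  set c : ℝ := m + 4 with hcdef
  have hc : 0 < c := by rw [hcdef]; linarith
  set θ : ℝ := 4 / c with hθ
  have hθ1 : θ < 1 := by rw [hθ, div_lt_one hc, hcdef]; linarith
  have hθ0 : 0 ≤ θ := by positivity
  set x : Matrix (TorusSite 4 L × Fin N × Fin 4) (TorusSite 4 L × Fin N × Fin 4) ℂ :=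
    1 - ((c : ℝ) : ℂ)⁻¹ • wilsonDirac ρ U m 1 with hx
  have hxn : ‖x‖ ≤ θ := norm_one_sub_smul_wilsonDirac_le ρ hρ U m hc
  have hxn1 : ‖x‖ < 1 := hxn.trans_lt hθ1
  set S : Matrix (TorusSite 4 L × Fin N × Fin 4) (TorusSite 4 L × Fin N × Fin 4) ℂ := ∑' n, x ^ n
    with hSdef
  have hS1 : (1 - x) * S = 1 := mul_neg_geom_series x hxn1
  have hc' : ((c : ℝ) : ℂ) ≠ 0 := by exact_mod_cast hc.ne'
  have hD : wilsonDirac ρ U m 1 = ((c : ℝ) : ℂ) • (1 - x) := by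
    rw [hx, sub_sub_cancel, smul_smul, mul_inv_cancel₀ hc', one_smul]
  have hinv : wilsonDirac ρ U m 1 * (((c : ℝ) : ℂ)⁻¹ • S) = 1 := by
    rw [hD, smul_mul_smul_comm, mul_inv_cancel₀ hc', one_smul, hS1]
  have hdet : (wilsonDirac ρ U m 1).det ≠ 0 := by
    intro h0
    have := congrArg Matrix.det hinv
    rw [Matrix.det_mul, h0, zero_mul, Matrix.det_one] at this
    exact zero_ne_one this
  refine ⟨hdet, ?_⟩
  rw [Matrix.inv_eq_right_inv hinv, Matrix.smul_apply, norm_smul, norm_inv, Complex.norm_real,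
    Real.norm_eq_abs, abs_of_pos hc, mul_assoc]
  gcongr
  set d : ℕ := (p.1 i - q.1 i).valMinAbs.natAbs with hd
  have hNN : ∀ p' q' : TorusSite 4 L × Fin N × Fin 4,
      ¬ (p'.1 = q'.1 ∨ ∃ μ, q'.1 = QuantumFieldTheory.Site.shift p'.1 μ ∨
          p'.1 = QuantumFieldTheory.Site.shift q'.1 μ) → x p' q' = 0 := by
    intro p' q' h
    have hpq : p' ≠ q' := fun e => h (Or.inl (by rw [e]))
    simp only [not_or, not_exists] at h
    rw [hx, Matrix.sub_apply, Matrix.smul_apply, Matrix.one_apply_ne hpq,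
      wilsonDirac_apply_eq_zero_of_far ρ U m 1 h.1 (fun μ => (h.2 μ).1) (fun μ => (h.2 μ).2),
      smul_zero, sub_zero]
  have htail := geom_series_eq_sum_add_pow_mul hS1 d
  have hzero : (∑ n ∈ Finset.range d, x ^ n) p q = 0 := by
    rw [Matrix.sum_apply]
    exact Finset.sum_eq_zero fun n hn =>
      pow_apply_eq_zero_of_lt_valMinAbs hNN i n p q (Finset.mem_range.1 hn)
  have hSpq : S p q = (x ^ d * S) p q := by
    conv_lhs => rw [htail]
    rw [Matrix.add_apply, hzero, zero_add]
  have hSnorm : ‖S‖ ≤ (1 - θ)⁻¹ := by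
    refine (tsum_geometric_le_of_norm_lt_one x hxn1).trans ?_
    have h1 := l2_opNorm_torusFermion_one_le (L := L) (N := N)
    have h2 : (1 - ‖x‖)⁻¹ ≤ (1 - θ)⁻¹ := by
      apply inv_anti₀ (by linarith) (by linarith)
    linarith
  have hxd : ‖x ^ d‖ ≤ θ ^ d := by
    rcases Nat.eq_zero_or_pos d with h0 | hpos
    · rw [h0, pow_zero, pow_zero]; exact l2_opNorm_torusFermion_one_le
    · exact (norm_pow_le' x hpos).trans (pow_le_pow_left₀ (norm_nonneg _) hxn d)
  calc ‖S p q‖ = ‖(x ^ d * S) p q‖ := by rw [hSpq]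
    _ ≤ ‖x ^ d * S‖ := norm_apply_le_l2_opNorm _ p q
    _ ≤ ‖x ^ d‖ * ‖S‖ := norm_mul_le _ _
    _ ≤ θ ^ d * (1 - θ)⁻¹ := mul_le_mul hxd hSnorm (norm_nonneg _) (pow_nonneg hθ0 d)
    _ = (1 - 4 / (m + 4))⁻¹ * (4 / (m + 4)) ^ d := by rw [hθ, hcdef, mul_comm]

/-- The prefactor in closed form: `(m+4)⁻¹ (1 − 4/(m+4))⁻¹ = m⁻¹` for `m > 0`. [folklore] -/
theorem heavy_prefactor_eq {m : ℝ} (hm : 0 < m) : (m + 4)⁻¹ * (1 - 4 / (m + 4))⁻¹ = m⁻¹ := by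
  have hc : m + 4 ≠ 0 := by linarith
  rw [show 1 - 4 / (m + 4) = m / (m + 4) by field_simp; ring, inv_div, ← mul_div_assoc,
    inv_mul_cancel₀ hc, one_div]

/-- **`det D_W(m) ≠ 0` for `m > 0`** on every periodic torus, every gauge field. [cite: MontvayMunster1994, §4.1 and §5.1 (hopping parameter expansion)] -/
theorem wilsonDirac_det_ne_zero_of_pos (hρ : ∀ g, ρ g ∈ Matrix.unitaryGroup (Fin N) ℂ)
    (U : GaugeConfig 4 L G) {m : ℝ} (hm : 0 < m) : (wilsonDirac ρ U m 1).det ≠ 0 := by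
  rcases isEmpty_or_nonempty (TorusSite 4 L × Fin N × Fin 4) with h | ⟨⟨p⟩⟩
  · simp [Matrix.det_isEmpty]
  · exact (norm_inv_wilsonDirac_apply_le ρ hρ U hm p p 0).1

end Neumann

end Literature.MathematicalPhysics.QuantumLattice

end
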